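import Summits.QuantumFields.YangMills.Theorems.ColdStartUniversalityLatticeLangevinEntropyFisherCalculus
import Mathlib.Analysis.SpecialFunctions.Log.NegMulLog
import HarnessLib

/-!
# Route `ColdStartUniversality` (fixed-cut-off package, Bakry–Émery side, log-Sobolev half): the LARGE-TIME LIMITS of the entropy
# and of `∫ κ_T(𝓛q)·log κ_TQ dμ` along the SZZ semigroup at a fixed cut-off

Helper file (seat `ym-line-csu-p1`, g26; `--supports stmt-QuantumFields-24809`).  For the SU(2) lattice Langevin dynamics of
Shen–Zhu–Zhu on `(ℤ/L)³` at a FIXED cut-off and coupling `β'` (`μ = μ_(β')`, `𝓛 = 𝓛_(β')`, `κ_t` any realising kernel family) and a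
positive `C³` compactly supported cylinder density `Q = q∘coords`:
* ★ `tendsto_entropy_transition_atTop` — `∫ κ_TQ·log κ_TQ dμ → m log m` (`m = ∫ Q dμ`) as `T → ∞`;
* ★ `tendsto_fisher_transition_atTop` — `∫ κ_T(𝓛q)·log κ_TQ dμ → 0` as `T → ∞`;
both from the FIXED-CUT-OFF `L²` spectral gap `wilson_spectralGap_explicit` (rate `(3/2)e^(−4|β'|#𝒫)`, whatever it is — only `→ 0` is
used), the Lipschitz bound of `u log u` on `[δ, M]`, and ★ `sq_integral_abs_le_integral_sq` (`(∫|u|)² ≤ ∫ u²` on a probability space).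
These limits close the Bakry–Émery entropy argument (`Ent(κ_TQ) → 0`).  THEOREMS ONLY, no definition, no sorry.
HONEST FRAMING: fixed cut-off; nothing K-uniform; no crux, rung or summit statement is proved; the Yang–Mills mass gap is NOT proved.
-/

set_option autoImplicit false

noncomputable section

namespace Summit.QuantumFields.YangMills.Theorems.ColdStartUniversality

open MeasureTheory ProbabilityTheory Finset Filter Set
open scoped BigOperators NNReal ENNReal Topology
open Literature.Probability.Process Literature.MathematicalPhysics.QuantumFieldTheory
open Literature.MathematicalPhysics.QuantumLattice (fundamentalRep fundamentalLatticeRep continuous_fundamentalRep)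

variable {L : ℕ} [NeZero L]

/-! ## §1. Two elementary tools -/

/-- `(∫ |u| dμ)² ≤ ∫ u² dμ` on a probability space (Cauchy–Schwarz / Jensen, via `0 ≤ ∫ (|u| − ∫|u|)²`). [folklore] -/
theorem sq_integral_abs_le_integral_sq {X : Type*} [MeasurableSpace X] (μ : Measure X) [IsProbabilityMeasure μ] {u : X → ℝ}
    (hu : Integrable u μ) (hu2 : Integrable (fun x => u x ^ 2) μ) :
    (∫ x, |u x| ∂μ) ^ 2 ≤ ∫ x, u x ^ 2 ∂μ := by
  set a : ℝ := ∫ x, |u x| ∂μ with ha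
  have h0 : 0 ≤ ∫ x, (|u x| - a) ^ 2 ∂μ := integral_nonneg fun x => sq_nonneg _
  have hia : Integrable (fun x => 2 * a * |u x|) μ := hu.abs.const_mul _
  have e : (fun x => (|u x| - a) ^ 2) = fun x => (u x ^ 2 - 2 * a * |u x|) + a ^ 2 := by
    funext x; rw [sub_sq, sq_abs]; ring
  have hi1 : Integrable (fun x => u x ^ 2 - 2 * a * |u x|) μ := hu2.sub hia
  have h1 : ∫ x, (|u x| - a) ^ 2 ∂μ = (∫ x, u x ^ 2 ∂μ) - 2 * a * a + a ^ 2 := by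
    rw [e, integral_add hi1 (integrable_const _), integral_sub hu2 hia, integral_const_mul, ← ha]
    simp
  nlinarith [h0, h1]

/-- **Lipschitz bound for `u log u` on `[δ, M]`** (`0 < δ`): `|u log u − v log v| ≤ (max |log δ| |log M| + 1)·|u − v|`. [folklore] -/
theorem abs_mul_log_sub_mul_log_le {δ M u v : ℝ} (hδ : 0 < δ) (hu : u ∈ Icc δ M) (hv : v ∈ Icc δ M) :
    |u * Real.log u - v * Real.log v| ≤ (max |Real.log δ| |Real.log M| + 1) * |u - v| := by
  have hdiff : ∀ x ∈ Icc δ M, DifferentiableAt ℝ (fun x => x * Real.log x) x := fun x hx =>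
    (Real.hasDerivAt_mul_log (hδ.trans_le hx.1).ne').differentiableAt
  have hbound : ∀ x ∈ Icc δ M, ‖deriv (fun x => x * Real.log x) x‖ ≤ max |Real.log δ| |Real.log M| + 1 := by
    intro x hx
    have hx0 : 0 < x := hδ.trans_le hx.1
    rw [Real.deriv_mul_log hx0.ne', Real.norm_eq_abs]
    have h1 : Real.log δ ≤ Real.log x := Real.log_le_log hδ hx.1
    have h2 : Real.log x ≤ Real.log M := Real.log_le_log hx0 hx.2
    refine (abs_add_le _ _).trans ?_
    rw [abs_one]
    refine add_le_add ?_ le_rfl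
    rw [abs_le]
    constructor
    · linarith [neg_abs_le (Real.log δ), le_max_left |Real.log δ| |Real.log M|]
    · linarith [le_abs_self (Real.log M), le_max_right |Real.log δ| |Real.log M|]
  have h := (convex_Icc δ M).norm_image_sub_le_of_norm_deriv_le hdiff hbound hv hu
  simpa only [Real.norm_eq_abs] using h

/-! ## §2. The limits -/

/-- ★ **`Ent_μ(κ_TQ) → 0`**: for a positive `C³` compactly supported cylinder density `Q = q∘coords` and any realising kernel family,
`∫ κ_TQ·log κ_TQ dμ_(β') → m·log m`, `m = ∫ Q dμ_(β')`, as `T → ∞` (fixed-cut-off `L²` gap + Lipschitz `u log u`).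
[cite: BakryGentilLedoux2014, Thm 4.2.5] -/
theorem tendsto_entropy_transition_atTop (L : ℕ) [NeZero L] (β' : ℝ)
    (κ : ℝ≥0 → Kernel (GaugeConfig 3 L (Matrix.specialUnitaryGroup (Fin 2) ℂ))
      (GaugeConfig 3 L (Matrix.specialUnitaryGroup (Fin 2) ℂ))) [∀ t, IsMarkovKernel (κ t)]
    (hreal : ∀ (t : ℝ≥0) (x : GaugeConfig 3 L (Matrix.specialUnitaryGroup (Fin 2) ℂ))
        (Ω : Type) [MeasurableSpace Ω] (P : Measure Ω) [IsProbabilityMeasure P]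
        (W : ℝ≥0 → Ω → (Edge 3 L × NoiseIdx 2 → ℝ)) (hW : IsFlatBrownian W P)
        (U : ℝ≥0 → Ω → GaugeConfig 3 L (Matrix.specialUnitaryGroup (Fin 2) ℂ)),
        (∀ ω, U 0 ω = x) →
        (latticeLangevinDynamics (fundamentalLatticeRep 2) β').IsSolution (fundamentalRep (Fin 2))
          hW.natFiltration P W U →
        κ t x = P.map (U t))
    {q : (Edge 3 L × Fin 2 × Fin 2 × Bool → ℝ) → ℝ} (hq : ContDiff ℝ 3 q) (hqc : HasCompactSupport q) :
    let coords : GaugeConfig 3 L (Matrix.specialUnitaryGroup (Fin 2) ℂ) → (Edge 3 L × Fin 2 × Fin 2 × Bool → ℝ) :=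
      fun V q => (fun z : ℂ => if q.2.2.2 then z.im else z.re)
        ((fundamentalRep (Fin 2) (V q.1) : Matrix (Fin 2) (Fin 2) ℂ) q.2.1 q.2.2.1)
    (∀ x, 0 < q (coords x)) →
    Tendsto (fun T : ℝ => ∫ x, (∫ y, q (coords y) ∂(κ (T : ℝ).toNNReal x)) * Real.log (∫ y, q (coords y) ∂(κ (T : ℝ).toNNReal x)) ∂(wilsonMeasure (d := 3) (L := L) (fundamentalRep (Fin 2)) β')) atTop
      (𝓝 ((∫ x, q (coords x) ∂(wilsonMeasure (d := 3) (L := L) (fundamentalRep (Fin 2)) β')) * Real.log (∫ x, q (coords x) ∂(wilsonMeasure (d := 3) (L := L) (fundamentalRep (Fin 2)) β')))) := by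
  intro coords hpos
  classical
  haveI := secondCountableTopology_su2
  haveI := borelSpace_config L
  set μ : Measure (GaugeConfig 3 L (Matrix.specialUnitaryGroup (Fin 2) ℂ)) := (wilsonMeasure (d := 3) (L := L) (fundamentalRep (Fin 2)) β') with hμ
  haveI : IsProbabilityMeasure μ :=
    isProbabilityMeasure_wilsonMeasure (d := 3) (L := L) (fundamentalRep (Fin 2)) (continuous_fundamentalRep (Fin 2)) β'
  have hco : Continuous coords := continuous_coords (L := L)
  have hQc : Continuous fun V => q (coords V) := hq.continuous.comp hco
  obtain ⟨M, hMq, -, -, hPFb, -, hPFcx, -, -, -, -, -, -⟩ := transition_cylinder_toolkit L β' κ hreal hq hqc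
  obtain ⟨δ, hδ, hQδ⟩ : ∃ δ : ℝ, 0 < δ ∧ ∀ x : (GaugeConfig 3 L (Matrix.specialUnitaryGroup (Fin 2) ℂ)), δ ≤ q (coords x) := by
    obtain ⟨x₀, -, hx₀⟩ := isCompact_univ.exists_isMinOn (Set.univ_nonempty) hQc.continuousOn
    exact ⟨q (coords x₀), hpos x₀, fun x => hx₀ (Set.mem_univ x)⟩
  obtain ⟨PF, hPF⟩ : ∃ PF : ℝ → (GaugeConfig 3 L (Matrix.specialUnitaryGroup (Fin 2) ℂ)) → ℝ, PF = fun τ x => (∫ y, q (coords y) ∂(κ (τ : ℝ).toNNReal x)) := ⟨_, rfl⟩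
  set m : ℝ := ∫ x, q (coords x) ∂μ with hm
  have hPFδ : ∀ τ x, δ ≤ PF τ x := fun τ x => by rw [hPF]; exact le_transition_of_le L κ hQc hQδ _ x
  have hPFM : ∀ τ x, PF τ x ≤ M := fun τ x => by rw [hPF]; exact (le_abs_self _).trans (hPFb τ x)
  have hPFcx' : ∀ τ, Continuous fun x => PF τ x := fun τ => by rw [hPF]; exact hPFcx τ
  have hmδ : δ ≤ m := by
    calc δ = ∫ _x, δ ∂μ := by simp
      _ ≤ m := integral_mono (integrable_const _) (integrable_of_continuous_of_compactSpace hQc _) fun x => hQδ x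
  have hmM : m ≤ M :=
    calc m ≤ ∫ _x, M ∂μ := integral_mono (integrable_of_continuous_of_compactSpace hQc _) (integrable_const _)
          fun x => (le_abs_self _).trans (hMq x)
      _ = M := by simp
  set C : ℝ := max |Real.log δ| |Real.log M| + 1 with hC
  have hC0 : 0 ≤ C := by positivity
  -- pointwise Lipschitz estimate and its integral
  have hpt : ∀ T x, |PF T x * Real.log (PF T x) - m * Real.log m| ≤ C * |PF T x - m| := fun T x =>
    abs_mul_log_sub_mul_log_le hδ ⟨hPFδ T x, hPFM T x⟩ ⟨hmδ, hmM⟩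
  have hlogcx : ∀ τ, Continuous fun x => Real.log (PF τ x) := fun τ =>
    (hPFcx' τ).log fun x => (hδ.trans_le (hPFδ τ x)).ne'
  have hest : ∀ T : ℝ, |(∫ x, PF T x * Real.log (PF T x) ∂μ) - m * Real.log m| ≤
      C * Real.sqrt (∫ x, (PF T x - m) ^ 2 ∂μ) := by
    intro T
    have hi1 : Integrable (fun x => PF T x * Real.log (PF T x)) μ :=
      integrable_of_continuous_of_compactSpace ((hPFcx' T).mul (hlogcx T)) _
    have hi2 : Integrable (fun x => PF T x - m) μ := integrable_of_continuous_of_compactSpace ((hPFcx' T).sub continuous_const) _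
    have hi3 : Integrable (fun x => (PF T x - m) ^ 2) μ :=
      integrable_of_continuous_of_compactSpace (((hPFcx' T).sub continuous_const).pow 2) _
    have e1 : (∫ x, PF T x * Real.log (PF T x) ∂μ) - m * Real.log m = ∫ x, (PF T x * Real.log (PF T x) - m * Real.log m) ∂μ := by
      rw [integral_sub hi1 (integrable_const _)]
      simp
    rw [e1]
    calc |∫ x, (PF T x * Real.log (PF T x) - m * Real.log m) ∂μ| ≤ ∫ x, |PF T x * Real.log (PF T x) - m * Real.log m| ∂μ :=
          abs_integral_le_integral_abs
      _ ≤ ∫ x, C * |PF T x - m| ∂μ := integral_mono_of_nonneg (ae_of_all _ fun x => abs_nonneg _) (hi2.abs.const_mul _)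
          (ae_of_all _ fun x => hpt T x)
      _ = C * ∫ x, |PF T x - m| ∂μ := integral_const_mul _ _
      _ ≤ C * Real.sqrt (∫ x, (PF T x - m) ^ 2 ∂μ) := by
          refine mul_le_mul_of_nonneg_left ?_ hC0
          rw [← Real.sqrt_sq (integral_nonneg fun x => abs_nonneg _)]
          exact Real.sqrt_le_sqrt (sq_integral_abs_le_integral_sq μ hi2 hi3)
  -- the `L²` decay at the fixed cut-off
  have hdecay : ∀ T : ℝ, 0 ≤ T → ∫ x, (PF T x - m) ^ 2 ∂μ ≤ Real.exp (-2 * ((3 / 2 : ℝ) * Real.exp (-(|β'| * (4 * (Fintype.card (Plaquette 3 L) : ℝ))))) * T) * ∫ x, (q (coords x) - m) ^ 2 ∂μ := by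
    intro T hT
    have h := wilson_spectralGap_explicit L β' κ hreal hQc T.toNNReal
    rw [Real.coe_toNNReal _ hT] at h
    have e : ∫ x, (PF T x - m) ^ 2 ∂μ = ∫ x, ((∫ y, q (coords y) ∂(κ T.toNNReal x)) - m) ^ 2 ∂μ := by rw [hPF]
    rw [e]
    exact h
  -- squeeze
  set V0 : ℝ := ∫ x, (q (coords x) - m) ^ 2 ∂μ with hV0
  have hV0 : 0 ≤ V0 := integral_nonneg fun x => sq_nonneg _
  have hb : Tendsto (fun T : ℝ => C * Real.sqrt (Real.exp (-2 * ((3 / 2 : ℝ) * Real.exp (-(|β'| * (4 * (Fintype.card (Plaquette 3 L) : ℝ))))) * T) * V0)) atTop (𝓝 0) := by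
    have hlam : 0 < ((3 / 2 : ℝ) * Real.exp (-(|β'| * (4 * (Fintype.card (Plaquette 3 L) : ℝ))))) := wilson_explicitGap_pos L β'
    have h1 : Tendsto (fun T : ℝ => -2 * ((3 / 2 : ℝ) * Real.exp (-(|β'| * (4 * (Fintype.card (Plaquette 3 L) : ℝ))))) * T) atTop atBot :=
      tendsto_id.const_mul_atTop_of_neg (by linarith)
    have h2 : Tendsto (fun T : ℝ => Real.exp (-2 * ((3 / 2 : ℝ) * Real.exp (-(|β'| * (4 * (Fintype.card (Plaquette 3 L) : ℝ))))) * T) * V0) atTop (𝓝 (0 * V0)) :=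
      (Real.tendsto_exp_atBot.comp h1).mul_const V0
    rw [zero_mul] at h2
    have h3 := (Real.continuous_sqrt.tendsto 0).comp h2
    rw [Real.sqrt_zero] at h3
    simpa using h3.const_mul C
  have hgoal : (fun T : ℝ => ∫ x, (∫ y, q (coords y) ∂(κ (T : ℝ).toNNReal x)) * Real.log (∫ y, q (coords y) ∂(κ (T : ℝ).toNNReal x)) ∂μ) = fun T => ∫ x, PF T x * Real.log (PF T x) ∂μ := by
    rw [hPF]
  rw [hgoal, Metric.tendsto_atTop]
  intro ε hε
  have hb' := (Metric.tendsto_atTop.1 hb) ε hε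
  obtain ⟨N, hN⟩ := hb'
  refine ⟨max N 0, fun T hT => ?_⟩
  have hT0 : 0 ≤ T := le_trans (le_max_right _ _) hT
  have hTN : N ≤ T := le_trans (le_max_left _ _) hT
  have h1 := hN T hTN
  rw [Real.dist_eq, sub_zero] at h1
  rw [Real.dist_eq]
  have hsq : Real.sqrt (∫ x, (PF T x - m) ^ 2 ∂μ) ≤ Real.sqrt (Real.exp (-2 * ((3 / 2 : ℝ) * Real.exp (-(|β'| * (4 * (Fintype.card (Plaquette 3 L) : ℝ))))) * T) * V0) :=
    Real.sqrt_le_sqrt (hdecay T hT0)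
  have hnn : 0 ≤ C * Real.sqrt (Real.exp (-2 * ((3 / 2 : ℝ) * Real.exp (-(|β'| * (4 * (Fintype.card (Plaquette 3 L) : ℝ))))) * T) * V0) := mul_nonneg hC0 (Real.sqrt_nonneg _)
  calc |(∫ x, PF T x * Real.log (PF T x) ∂μ) - m * Real.log m| ≤ C * Real.sqrt (∫ x, (PF T x - m) ^ 2 ∂μ) := hest T
    _ ≤ C * Real.sqrt (Real.exp (-2 * ((3 / 2 : ℝ) * Real.exp (-(|β'| * (4 * (Fintype.card (Plaquette 3 L) : ℝ))))) * T) * V0) := mul_le_mul_of_nonneg_left hsq hC0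
    _ < ε := by rw [abs_of_nonneg hnn] at h1; exact h1

/-- ★ **`∫ κ_T(𝓛q)·log κ_TQ dμ_(β') → 0`** as `T → ∞`, for a positive `C³` compactly supported cylinder density `Q = q∘coords` and any
realising kernel family (`κ_T(𝓛q) → ∫ 𝓛q dμ = 0` in `L²(μ)` by the fixed-cut-off gap, `log κ_TQ` bounded). [cite: BakryGentilLedoux2014, Thm 4.2.5] -/
theorem tendsto_fisher_transition_atTop (L : ℕ) [NeZero L] (β' : ℝ)
    (κ : ℝ≥0 → Kernel (GaugeConfig 3 L (Matrix.specialUnitaryGroup (Fin 2) ℂ))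
      (GaugeConfig 3 L (Matrix.specialUnitaryGroup (Fin 2) ℂ))) [∀ t, IsMarkovKernel (κ t)]
    (hreal : ∀ (t : ℝ≥0) (x : GaugeConfig 3 L (Matrix.specialUnitaryGroup (Fin 2) ℂ))
        (Ω : Type) [MeasurableSpace Ω] (P : Measure Ω) [IsProbabilityMeasure P]
        (W : ℝ≥0 → Ω → (Edge 3 L × NoiseIdx 2 → ℝ)) (hW : IsFlatBrownian W P)
        (U : ℝ≥0 → Ω → GaugeConfig 3 L (Matrix.specialUnitaryGroup (Fin 2) ℂ)),
        (∀ ω, U 0 ω = x) →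
        (latticeLangevinDynamics (fundamentalLatticeRep 2) β').IsSolution (fundamentalRep (Fin 2))
          hW.natFiltration P W U →
        κ t x = P.map (U t))
    {q : (Edge 3 L × Fin 2 × Fin 2 × Bool → ℝ) → ℝ} (hq : ContDiff ℝ 3 q) (hqc : HasCompactSupport q) :
    let coords : GaugeConfig 3 L (Matrix.specialUnitaryGroup (Fin 2) ℂ) → (Edge 3 L × Fin 2 × Fin 2 × Bool → ℝ) :=
      fun V q => (fun z : ℂ => if q.2.2.2 then z.im else z.re)
        ((fundamentalRep (Fin 2) (V q.1) : Matrix (Fin 2) (Fin 2) ℂ) q.2.1 q.2.2.1)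
    let gen : ((Edge 3 L × Fin 2 × Fin 2 × Bool → ℝ) → ℝ) → GaugeConfig 3 L (Matrix.specialUnitaryGroup (Fin 2) ℂ) → ℝ :=
      fun h V =>
      (∑ i : Edge 3 L × Fin 2 × Fin 2 × Bool, fderiv ℝ h (coords V) (Pi.single i 1) *
          (fun z : ℂ => if i.2.2.2 then z.im else z.re)
            ((latticeLangevinDynamics (fundamentalLatticeRep 2) β').drift
              (matrixConfig (fundamentalRep (Fin 2)) V) i.1 i.2.1 i.2.2.1) +
      1 / 2 * ∑ i : Edge 3 L × Fin 2 × Fin 2 × Bool, ∑ j : Edge 3 L × Fin 2 × Fin 2 × Bool,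
        fderiv ℝ (fun z => fderiv ℝ h z (Pi.single i 1)) (coords V) (Pi.single j 1) *
          ∑ n : Edge 3 L × NoiseIdx 2,
            (if n.1 = i.1 then (fun z : ℂ => if i.2.2.2 then z.im else z.re)
              ((latticeLangevinDynamics (fundamentalLatticeRep 2) β').noise
                (matrixConfig (fundamentalRep (Fin 2)) V) i.1 n.2 i.2.1 i.2.2.1) else 0) *
            (if n.1 = j.1 then (fun z : ℂ => if j.2.2.2 then z.im else z.re)
              ((latticeLangevinDynamics (fundamentalLatticeRep 2) β').noise
                (matrixConfig (fundamentalRep (Fin 2)) V) j.1 n.2 j.2.1 j.2.2.1) else 0))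
    (∀ x, 0 < q (coords x)) →
    Tendsto (fun T : ℝ => ∫ x, (∫ y, gen q y ∂(κ (T : ℝ).toNNReal x)) * Real.log (∫ y, q (coords y) ∂(κ (T : ℝ).toNNReal x)) ∂(wilsonMeasure (d := 3) (L := L) (fundamentalRep (Fin 2)) β')) atTop (𝓝 0) := by
  intro coords gen hpos
  classical
  haveI := secondCountableTopology_su2
  haveI := borelSpace_config L
  set μ : Measure (GaugeConfig 3 L (Matrix.specialUnitaryGroup (Fin 2) ℂ)) := (wilsonMeasure (d := 3) (L := L) (fundamentalRep (Fin 2)) β') with hμ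
  haveI : IsProbabilityMeasure μ :=
    isProbabilityMeasure_wilsonMeasure (d := 3) (L := L) (fundamentalRep (Fin 2)) (continuous_fundamentalRep (Fin 2)) β'
  have hco : Continuous coords := continuous_coords (L := L)
  have hQc : Continuous fun V => q (coords V) := hq.continuous.comp hco
  obtain ⟨M, -, -, hgenc, hPFb, hPGb, hPFcx, hPGcx, -, -, -, -, -⟩ := transition_cylinder_toolkit L β' κ hreal hq hqc
  obtain ⟨δ, hδ, hQδ⟩ : ∃ δ : ℝ, 0 < δ ∧ ∀ x : (GaugeConfig 3 L (Matrix.specialUnitaryGroup (Fin 2) ℂ)), δ ≤ q (coords x) := by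
    obtain ⟨x₀, -, hx₀⟩ := isCompact_univ.exists_isMinOn (Set.univ_nonempty) hQc.continuousOn
    exact ⟨q (coords x₀), hpos x₀, fun x => hx₀ (Set.mem_univ x)⟩
  obtain ⟨PF, hPF⟩ : ∃ PF : ℝ → (GaugeConfig 3 L (Matrix.specialUnitaryGroup (Fin 2) ℂ)) → ℝ, PF = fun τ x => (∫ y, q (coords y) ∂(κ (τ : ℝ).toNNReal x)) := ⟨_, rfl⟩
  obtain ⟨PG, hPG⟩ : ∃ PG : ℝ → (GaugeConfig 3 L (Matrix.specialUnitaryGroup (Fin 2) ℂ)) → ℝ, PG = fun τ x => (∫ y, gen q y ∂(κ (τ : ℝ).toNNReal x)) := ⟨_, rfl⟩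
  have hPFδ : ∀ τ x, δ ≤ PF τ x := fun τ x => by rw [hPF]; exact le_transition_of_le L κ hQc hQδ _ x
  have hPFpos : ∀ τ x, 0 < PF τ x := fun τ x => hδ.trans_le (hPFδ τ x)
  have hPFM : ∀ τ x, PF τ x ≤ M := fun τ x => by rw [hPF]; exact (le_abs_self _).trans (hPFb τ x)
  have hPFcx' : ∀ τ, Continuous fun x => PF τ x := fun τ => by rw [hPF]; exact hPFcx τ
  have hPGcx' : ∀ τ, Continuous fun x => PG τ x := fun τ => by rw [hPG]; exact hPGcx τ
  set C : ℝ := max |Real.log δ| |Real.log M| with hC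
  have hC0 : 0 ≤ C := le_trans (abs_nonneg _) (le_max_left _ _)
  have hlogb : ∀ τ x, |Real.log (PF τ x)| ≤ C := by
    intro τ x
    have h1 : Real.log δ ≤ Real.log (PF τ x) := Real.log_le_log hδ (hPFδ τ x)
    have h2 : Real.log (PF τ x) ≤ Real.log M := Real.log_le_log (hPFpos τ x) (hPFM τ x)
    rw [abs_le]
    constructor
    · linarith [neg_abs_le (Real.log δ), le_max_left |Real.log δ| |Real.log M|]
    · linarith [le_abs_self (Real.log M), le_max_right |Real.log δ| |Real.log M|]
  have hlogcx : ∀ τ, Continuous fun x => Real.log (PF τ x) := fun τ => (hPFcx' τ).log fun x => (hPFpos τ x).ne'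
  -- `∫ 𝓛q dμ = 0`
  have hgen0 : ∫ x, gen q x ∂μ = 0 := integral_generator_wilson_eq_zero L β' hq hqc
  have hest : ∀ T : ℝ, |∫ x, PG T x * Real.log (PF T x) ∂μ| ≤ C * Real.sqrt (∫ x, (PG T x - 0) ^ 2 ∂μ) := by
    intro T
    have hi2 : Integrable (fun x => PG T x - 0) μ := integrable_of_continuous_of_compactSpace ((hPGcx' T).sub continuous_const) _
    have hi3 : Integrable (fun x => (PG T x - 0) ^ 2) μ :=
      integrable_of_continuous_of_compactSpace (((hPGcx' T).sub continuous_const).pow 2) _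
    calc |∫ x, PG T x * Real.log (PF T x) ∂μ| ≤ ∫ x, |PG T x * Real.log (PF T x)| ∂μ := abs_integral_le_integral_abs
      _ ≤ ∫ x, C * |PG T x - 0| ∂μ := by
          refine integral_mono_of_nonneg (ae_of_all _ fun x => abs_nonneg _) (hi2.abs.const_mul _) (ae_of_all _ fun x => ?_)
          beta_reduce
          rw [abs_mul, sub_zero, mul_comm]
          exact mul_le_mul_of_nonneg_right (hlogb T x) (abs_nonneg _)
      _ = C * ∫ x, |PG T x - 0| ∂μ := integral_const_mul _ _
      _ ≤ C * Real.sqrt (∫ x, (PG T x - 0) ^ 2 ∂μ) := by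
          refine mul_le_mul_of_nonneg_left ?_ hC0
          rw [← Real.sqrt_sq (integral_nonneg fun x => abs_nonneg _)]
          exact Real.sqrt_le_sqrt (sq_integral_abs_le_integral_sq μ hi2 hi3)
  have hdecay : ∀ T : ℝ, 0 ≤ T → ∫ x, (PG T x - 0) ^ 2 ∂μ ≤ Real.exp (-2 * ((3 / 2 : ℝ) * Real.exp (-(|β'| * (4 * (Fintype.card (Plaquette 3 L) : ℝ))))) * T) * ∫ x, (gen q x - 0) ^ 2 ∂μ := by
    intro T hT
    have h := wilson_spectralGap_explicit L β' κ hreal hgenc T.toNNReal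
    rw [Real.coe_toNNReal _ hT, hgen0] at h
    have e : ∫ x, (PG T x - 0) ^ 2 ∂μ = ∫ x, ((∫ y, gen q y ∂(κ T.toNNReal x)) - 0) ^ 2 ∂μ := by rw [hPG]
    rw [e]
    exact h
  set V0 : ℝ := ∫ x, (gen q x - 0) ^ 2 ∂μ with hV0
  have hb : Tendsto (fun T : ℝ => C * Real.sqrt (Real.exp (-2 * ((3 / 2 : ℝ) * Real.exp (-(|β'| * (4 * (Fintype.card (Plaquette 3 L) : ℝ))))) * T) * V0)) atTop (𝓝 0) := by
    have hlam : 0 < ((3 / 2 : ℝ) * Real.exp (-(|β'| * (4 * (Fintype.card (Plaquette 3 L) : ℝ))))) := wilson_explicitGap_pos L β'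
    have h1 : Tendsto (fun T : ℝ => -2 * ((3 / 2 : ℝ) * Real.exp (-(|β'| * (4 * (Fintype.card (Plaquette 3 L) : ℝ))))) * T) atTop atBot :=
      tendsto_id.const_mul_atTop_of_neg (by linarith)
    have h2 : Tendsto (fun T : ℝ => Real.exp (-2 * ((3 / 2 : ℝ) * Real.exp (-(|β'| * (4 * (Fintype.card (Plaquette 3 L) : ℝ))))) * T) * V0) atTop (𝓝 (0 * V0)) :=
      (Real.tendsto_exp_atBot.comp h1).mul_const V0
    rw [zero_mul] at h2
    have h3 := (Real.continuous_sqrt.tendsto 0).comp h2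
    rw [Real.sqrt_zero] at h3
    simpa using h3.const_mul C
  have hgoal : (fun T : ℝ => ∫ x, (∫ y, gen q y ∂(κ (T : ℝ).toNNReal x)) * Real.log (∫ y, q (coords y) ∂(κ (T : ℝ).toNNReal x)) ∂μ) = fun T => ∫ x, PG T x * Real.log (PF T x) ∂μ := by
    rw [hPF, hPG]
  rw [hgoal, Metric.tendsto_atTop]
  intro ε hε
  obtain ⟨N, hN⟩ := (Metric.tendsto_atTop.1 hb) ε hε
  refine ⟨max N 0, fun T hT => ?_⟩
  have hT0 : 0 ≤ T := le_trans (le_max_right _ _) hT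
  have h1 := hN T (le_trans (le_max_left _ _) hT)
  rw [Real.dist_eq, sub_zero] at h1
  rw [Real.dist_eq, sub_zero]
  have hsq : Real.sqrt (∫ x, (PG T x - 0) ^ 2 ∂μ) ≤ Real.sqrt (Real.exp (-2 * ((3 / 2 : ℝ) * Real.exp (-(|β'| * (4 * (Fintype.card (Plaquette 3 L) : ℝ))))) * T) * V0) :=
    Real.sqrt_le_sqrt (hdecay T hT0)
  have hnn : 0 ≤ C * Real.sqrt (Real.exp (-2 * ((3 / 2 : ℝ) * Real.exp (-(|β'| * (4 * (Fintype.card (Plaquette 3 L) : ℝ))))) * T) * V0) := mul_nonneg hC0 (Real.sqrt_nonneg _)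
  calc |∫ x, PG T x * Real.log (PF T x) ∂μ| ≤ C * Real.sqrt (∫ x, (PG T x - 0) ^ 2 ∂μ) := hest T
    _ ≤ C * Real.sqrt (Real.exp (-2 * ((3 / 2 : ℝ) * Real.exp (-(|β'| * (4 * (Fintype.card (Plaquette 3 L) : ℝ))))) * T) * V0) := mul_le_mul_of_nonneg_left hsq hC0
    _ < ε := by rw [abs_of_nonneg hnn] at h1; exact h1

end Summit.QuantumFields.YangMills.Theorems.ColdStartUniversality
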